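import Literature.MeasureTheory.Group.InvariantQuotientNormalized
import HarnessLib

/-!
# The mass of a compact open subgroup in a coset space:
`(ν/ρ)(K H / H) · ρ(H ∩ K) = ν(K)`
(Deitmar–Echterhoff, *Principles of Harmonic Analysis* (2014), Thm. 1.5.3 (quotient integral
formula), applied to `f = 1_K`; Rogawski (1990), §4.3 p. 43 (the normalisation of local orbital
measures by `vol K_v = 1`, `vol (T(F_v) ∩ K_v) = 1`))

Topic `MeasureTheory/Group`; namespace `Literature.MeasureTheory.Group`. Theorems only (no
definition, no named fact, no instance). Setting of `InvariantQuotientNormalized`: `G` a locally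
compact second countable Hausdorff group with Borel σ-algebra, `H ≤ G` a closed subgroup with a
left-invariant measure `ρ` (finite on compacts, positive on opens, inversion invariant), `ν` a Haar
measure on `G` which is also right invariant, `ν/ρ = quotientMeasure H ρ hH ν` the invariant measure
on `G ⧸ H` satisfying Weil's formula with constant one
(`lintegral_fiberLIntegral_quotientMeasure`).

For an OPEN SUBGROUP `K ≤ G`:

* `fiberLIntegral_indicator_subgroup_mk_of_mem` / `fiberLIntegral_indicator_subgroup_eq` — the fibre
  integral of `1_K` is `ρ(H ∩ K)` on the image `K H / H` of `K` and `0` off it: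
  `∫_H 1_K(g h) dρ(h) = ρ(H ∩ K) · 1_{π(K)}(gH)` (for `g ∈ K`, `g h ∈ K ↔ h ∈ K`);
* `quotientMeasure_image_mk_mul_eq` — **`(ν/ρ)(π(K)) · ρ(H ∩ K) = ν(K)`** (Weil's formula with
  constant one on `f = 1_K`); more generally `lintegral`-unfolding for ANY `G`-invariant `μ` on
  `G ⧸ H` finite on compacts: `μ(π(K)) · ρ(H ∩ K) = c_μ · ν(K)` with `c_μ` the unfolding constant
  (`measure_image_mk_mul_eq_unfoldingConstant_mul`);
* for `K` moreover COMPACT: `0 < ρ(H ∩ K) < ∞` (`measure_preimage_subgroup_pos`,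
  `measure_preimage_subgroup_lt_top`), hence
  `quotientMeasure_image_mk_eq_div` — **`(ν/ρ)(π(K)) = ν(K) / ρ(H ∩ K)`** — and
  `quotientMeasure_image_mk_eq_one` — **`ν(K) = 1 → ρ(H ∩ K) = 1 → (ν/ρ)(π(K)) = 1`**.

Here `H ∩ K` is the subset `Subtype.val ⁻¹' K` of the subgroup type `↥H` on which `ρ` lives, and
`π(K) = QuotientGroup.mk '' K`. Purpose (HCML F0, T1 line, ED. 1.19 pin (viii′-3) «local orbital
measures normalisable off `S₀(γ)`»): with `G = G(F_v)`, `H = Z(γ_v)` the centraliser torus and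
`K = K_v` hyperspecial, the canonical orbital measure `ν_v/ρ_v` gives the orbit of `K_v` mass `1` as
soon as `ν_v(K_v) = 1` and `ρ_v(Z(γ_v) ∩ K_v) = 1` — Rogawski's normalisation at almost every place.

## References

* A. Deitmar, S. Echterhoff, *Principles of Harmonic Analysis*, 2nd ed. (2014), Thm. 1.5.3
  [DeitmarEchterhoff2014].
* J. D. Rogawski, *Automorphic Representations of Unitary Groups in Three Variables* (1990), §4.3
  p. 43 (measure normalisations) [Rogawski1990].
-/

noncomputable section

open _root_.MeasureTheory _root_.MeasureTheory.Measure _root_.Topology Set Filter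
open scoped ENNReal NNReal Pointwise

/- The coset space carries the Borel σ-algebra supplied as a section hypothesis
`[MeasurableSpace (G ⧸ H)] [BorelSpace (G ⧸ H)]` (a local instance, preferred to Mathlib's quotient
σ-algebra), as in `InvariantQuotientNormalized`. -/

namespace Literature.MeasureTheory.Group

/-! ### The fibre integral of the indicator of an open subgroup -/

section Fiber

variable {G : Type*} [Group G] [MeasurableSpace G] (H : Subgroup G) [MeasurableMul H]
  (ρ : Measure H) [ρ.IsMulLeftInvariant]

omit [MeasurableSpace G] [MeasurableMul H] in
/-- For a subgroup `K` and `g ∈ K`: `g h ∈ K ↔ h ∈ K`, so the integrand `h ↦ 1_K(g h)` of the fibre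
integral is the indicator of `H ∩ K` inside `H`. [folklore] -/
private theorem indicator_subgroup_mul_eq (K : Subgroup G) {g : G} (hg : g ∈ K) :
    (fun h : H => (K : Set G).indicator (1 : G → ℝ≥0∞) (g * (h : G))) =
      (Subtype.val ⁻¹' (K : Set G)).indicator (1 : H → ℝ≥0∞) := by
  funext h
  by_cases hh : (h : G) ∈ K
  · rw [Set.indicator_of_mem (show g * (h : G) ∈ (K : Set G) from K.mul_mem hg hh),
      Set.indicator_of_mem (show h ∈ Subtype.val ⁻¹' (K : Set G) from hh)]
    rfl
  · rw [Set.indicator_of_notMem, Set.indicator_of_notMem (show h ∉ Subtype.val ⁻¹' (K : Set G) from hh)]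
    intro hgh
    exact hh ((K.mul_mem_cancel_left hg).1 hgh)

/-- **The fibre integral of `1_K` at a point of `K`**: for a subgroup `K ≤ G` measurable in `G`
(with `Subtype.val : H → G` measurable) and `g ∈ K`, `∫_H 1_K(g h) dρ(h) = ρ(H ∩ K)`.
[cite: DeitmarEchterhoff2014, Thm. 1.5.3] -/
theorem fiberLIntegral_indicator_subgroup_mk_of_mem (K : Subgroup G)
    (hKH : MeasurableSet (Subtype.val ⁻¹' (K : Set G) : Set H)) {g : G} (hg : g ∈ K) :
    fiberLIntegral H ρ ((K : Set G).indicator 1) (QuotientGroup.mk g) =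
      ρ (Subtype.val ⁻¹' (K : Set G)) := by
  rw [fiberLIntegral_mk, indicator_subgroup_mul_eq H K hg, lintegral_indicator_one hKH]

/-- **The fibre integral of `1_K` everywhere**: `∫_H 1_K(g h) dρ(h) = ρ(H ∩ K) · 1_{π(K)}(gH)` — on
the image of `K` in `G ⧸ H` it is `ρ(H ∩ K)` (choose the representative in `K`), off the image it
vanishes (`fiberLIntegral_indicator_eq_zero`). [cite: DeitmarEchterhoff2014, Thm. 1.5.3] -/
theorem fiberLIntegral_indicator_subgroup_eq (K : Subgroup G)
    (hKH : MeasurableSet (Subtype.val ⁻¹' (K : Set G) : Set H)) (x : G ⧸ H) :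
    fiberLIntegral H ρ ((K : Set G).indicator 1) x =
      ρ (Subtype.val ⁻¹' (K : Set G)) *
        ((QuotientGroup.mk : G → G ⧸ H) '' (K : Set G)).indicator 1 x := by
  by_cases hx : x ∈ (QuotientGroup.mk : G → G ⧸ H) '' (K : Set G)
  · obtain ⟨k, hk, rfl⟩ := hx
    rw [fiberLIntegral_indicator_subgroup_mk_of_mem H ρ K hKH hk,
      Set.indicator_of_mem (Set.mem_image_of_mem _ hk), Pi.one_apply, mul_one]
  · obtain ⟨g, rfl⟩ := QuotientGroup.mk_surjective x
    rw [fiberLIntegral_indicator_eq_zero H ρ hx, Set.indicator_of_notMem hx, mul_zero]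

end Fiber

/-! ### The mass formula on `G ⧸ H` -/

section Mass

variable {G : Type*} [Group G] [TopologicalSpace G] [IsTopologicalGroup G] [LocallyCompactSpace G]
  [SecondCountableTopology G] [T2Space G] [MeasurableSpace G] [BorelSpace G]
  (H : Subgroup G) [hH : IsClosed (H : Set G)]
  (ρ : Measure H) [ρ.IsMulLeftInvariant] [IsFiniteMeasureOnCompacts ρ]
  [MeasurableSpace (G ⧸ H)] [BorelSpace (G ⧸ H)]

omit [IsTopologicalGroup G] [LocallyCompactSpace G] [SecondCountableTopology G] [T2Space G] hH
  [MeasurableSpace (G ⧸ H)] [BorelSpace (G ⧸ H)] in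
/-- `H ∩ K ⊆ H` is measurable for `K` open. [cite: DeitmarEchterhoff2014, Thm. 1.5.3] -/
theorem measurableSet_preimage_val_of_isOpen (K : Subgroup G) (hK : IsOpen (K : Set G)) :
    MeasurableSet (Subtype.val ⁻¹' (K : Set G) : Set H) :=
  (hK.preimage continuous_subtype_val).measurableSet

omit [LocallyCompactSpace G] [SecondCountableTopology G] [T2Space G] [MeasurableSpace G] [BorelSpace G]
  hH in
/-- `π(K) ⊆ G ⧸ H` is open, hence measurable, for `K` open (the quotient map is open).
[cite: DeitmarEchterhoff2014, Thm. 1.5.3] -/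
theorem measurableSet_image_mk_of_isOpen (K : Subgroup G) (hK : IsOpen (K : Set G)) :
    MeasurableSet ((QuotientGroup.mk : G → G ⧸ H) '' (K : Set G)) :=
  (QuotientGroup.isOpenMap_coe (K : Set G) hK).measurableSet

omit [IsTopologicalGroup G] [LocallyCompactSpace G] [SecondCountableTopology G] [T2Space G]
  [BorelSpace G] hH [ρ.IsMulLeftInvariant] [IsFiniteMeasureOnCompacts ρ] [MeasurableSpace (G ⧸ H)]
  [BorelSpace (G ⧸ H)] in
/-- `ρ(H ∩ K) > 0` for `K` open (`H ∩ K` is an open neighbourhood of `1` in `H`).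
[cite: DeitmarEchterhoff2014, Thm. 1.5.3] -/
theorem measure_preimage_subgroup_pos [ρ.IsOpenPosMeasure] (K : Subgroup G) (hK : IsOpen (K : Set G)) :
    0 < ρ (Subtype.val ⁻¹' (K : Set G)) :=
  (hK.preimage continuous_subtype_val).measure_pos ρ ⟨1, show ((1 : H) : G) ∈ K from K.one_mem⟩

omit [IsTopologicalGroup G] [LocallyCompactSpace G] [SecondCountableTopology G] [T2Space G]
  [BorelSpace G] [ρ.IsMulLeftInvariant] [MeasurableSpace (G ⧸ H)] [BorelSpace (G ⧸ H)] in
/-- `ρ(H ∩ K) < ∞` for `K` compact (`H ∩ K` is compact in the closed subgroup `H`).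
[cite: DeitmarEchterhoff2014, Thm. 1.5.3] -/
theorem measure_preimage_subgroup_lt_top (K : Subgroup G) (hKc : IsCompact (K : Set G)) :
    ρ (Subtype.val ⁻¹' (K : Set G)) < ∞ :=
  (hH.isClosedEmbedding_subtypeVal.isCompact_preimage hKc).measure_lt_top

/-- **Unfolding on `1_K` for any invariant measure**: for a `G`-invariant measure `μ` on `G ⧸ H`
finite on compact sets and an open subgroup `K`,
`μ(π(K)) · ρ(H ∩ K) = c_μ · ν(K)`, `c_μ = unfoldingConstant H ρ μ ν`
(`lintegral_fiberLIntegral_eq_mul_lintegral` with `f = 1_K`). [cite: DeitmarEchterhoff2014, Thm. 1.5.3] -/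
theorem measure_image_mk_mul_eq_unfoldingConstant_mul (μ : Measure (G ⧸ H))
    [IsFiniteMeasureOnCompacts μ] [SMulInvariantMeasure G (G ⧸ H) μ]
    (ν : Measure G) [IsHaarMeasure ν] (K : Subgroup G) (hK : IsOpen (K : Set G)) :
    μ ((QuotientGroup.mk : G → G ⧸ H) '' (K : Set G)) * ρ (Subtype.val ⁻¹' (K : Set G)) =
      unfoldingConstant H ρ μ ν * ν K := by
  have hKm : MeasurableSet (K : Set G) := hK.measurableSet
  have h := lintegral_fiberLIntegral_eq_mul_lintegral H ρ μ ν
    ((measurable_one.indicator hKm : Measurable ((K : Set G).indicator (1 : G → ℝ≥0∞))))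
  rw [lintegral_indicator_one hKm] at h
  have hfib : (fun x => fiberLIntegral H ρ ((K : Set G).indicator 1) x) = fun x =>
      ((QuotientGroup.mk : G → G ⧸ H) '' (K : Set G)).indicator 1 x * ρ (Subtype.val ⁻¹' (K : Set G)) := by
    funext x
    rw [fiberLIntegral_indicator_subgroup_eq H ρ K (measurableSet_preimage_val_of_isOpen H K hK) x,
      mul_comm]
  rw [hfib, lintegral_mul_const _ (measurable_one.indicator (measurableSet_image_mk_of_isOpen H K hK)),
    lintegral_indicator_one (measurableSet_image_mk_of_isOpen H K hK)] at h
  exact h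

variable [ρ.IsOpenPosMeasure] [ρ.IsInvInvariant] [SFinite ρ]
  (ν : Measure G) [IsHaarMeasure ν] [ν.IsMulRightInvariant]

/-- **Mass formula for the quotient measure**: for an open subgroup `K ≤ G`,
`(ν/ρ)(π(K)) · ρ(H ∩ K) = ν(K)` — Weil's formula with constant one
(`lintegral_fiberLIntegral_quotientMeasure`) on `f = 1_K`, whose fibre integral is
`ρ(H ∩ K) · 1_{π(K)}`. [cite: DeitmarEchterhoff2014, Thm. 1.5.3] -/
theorem quotientMeasure_image_mk_mul_eq (K : Subgroup G) (hK : IsOpen (K : Set G)) :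
    quotientMeasure H ρ hH ν ((QuotientGroup.mk : G → G ⧸ H) '' (K : Set G)) *
        ρ (Subtype.val ⁻¹' (K : Set G)) = ν K := by
  rw [measure_image_mk_mul_eq_unfoldingConstant_mul H ρ (quotientMeasure H ρ hH ν) ν K hK,
    unfoldingConstant_quotientMeasure H ρ ν, ENNReal.coe_one, one_mul]

/-- **`(ν/ρ)(π(K)) = ν(K) / ρ(H ∩ K)`** for a compact open subgroup `K` (then
`0 < ρ(H ∩ K) < ∞`). [cite: DeitmarEchterhoff2014, Thm. 1.5.3] -/
theorem quotientMeasure_image_mk_eq_div (K : Subgroup G) (hK : IsOpen (K : Set G))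
    (hKc : IsCompact (K : Set G)) :
    quotientMeasure H ρ hH ν ((QuotientGroup.mk : G → G ⧸ H) '' (K : Set G)) =
      ν K / ρ (Subtype.val ⁻¹' (K : Set G)) := by
  rw [← quotientMeasure_image_mk_mul_eq H ρ ν K hK]
  exact (ENNReal.mul_div_cancel_right (measure_preimage_subgroup_pos H ρ K hK).ne'
    (measure_preimage_subgroup_lt_top H ρ K hKc).ne).symm

/-- **Normalised case**: if `ν(K) = 1` and `ρ(H ∩ K) = 1` then `(ν/ρ)(π(K)) = 1` — the canonical
quotient measure gives the `K`-orbit of the base point mass one (Rogawski (1990), §4.3: the local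
measures with `vol K_v = 1`, `vol (T ∩ K_v) = 1` at the unramified places).
[cite: Rogawski1990, §4.3 (p. 43)] -/
theorem quotientMeasure_image_mk_eq_one (K : Subgroup G) (hK : IsOpen (K : Set G))
    (hν : ν K = 1) (hρ : ρ (Subtype.val ⁻¹' (K : Set G)) = 1) :
    quotientMeasure H ρ hH ν ((QuotientGroup.mk : G → G ⧸ H) '' (K : Set G)) = 1 := by
  have h := quotientMeasure_image_mk_mul_eq H ρ ν K hK
  rwa [hρ, mul_one, hν] at h

omit [ρ.IsInvInvariant] [ν.IsMulRightInvariant] in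
/-- The same mass formula for ANY `G`-invariant `μ` finite on compacts, in divided form:
`μ(π(K)) = c_μ · ν(K) / ρ(H ∩ K)` for a compact open subgroup `K`. [cite: DeitmarEchterhoff2014, Thm. 1.5.3] -/
theorem measure_image_mk_eq_unfoldingConstant_mul_div (μ : Measure (G ⧸ H))
    [IsFiniteMeasureOnCompacts μ] [SMulInvariantMeasure G (G ⧸ H) μ]
    (K : Subgroup G) (hK : IsOpen (K : Set G)) (hKc : IsCompact (K : Set G)) :
    μ ((QuotientGroup.mk : G → G ⧸ H) '' (K : Set G)) =
      unfoldingConstant H ρ μ ν * ν K / ρ (Subtype.val ⁻¹' (K : Set G)) := by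
  rw [← measure_image_mk_mul_eq_unfoldingConstant_mul H ρ μ ν K hK]
  exact (ENNReal.mul_div_cancel_right (measure_preimage_subgroup_pos H ρ K hK).ne'
    (measure_preimage_subgroup_lt_top H ρ K hKc).ne).symm

end Mass

end Literature.MeasureTheory.Group
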